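import Summits.BirchSwinnertonDyer.BirchSwinnertonDyer.Theses.InertBadSignedBranches
import Summits.BirchSwinnertonDyer.BirchSwinnertonDyer.Theorems.InertBadSignedBranchesPlusMCEtaKUpToMu
import HarnessLib

/-!
# Route `InertBadSignedBranches` (rung K8): GLUE of the by-name split of item 19501 `PlusMCEtaK`

HONEST FRAMING (cell bsd-cm): BSD is NOT proved by any of this. This file closes the GLUE item of the
split of the residual crux 19501 (planner bsd-cm-plan g20):
`PlusMCEtaKMuPart → PlusMCEtaKUpToMu → PublishedInputsEtaUpToP → PlusMCEtaK` — the `μ`-part, the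
`μ`-free part from print and the two named facts RECOVER Kobayashi's even `η`-main conjecture verbatim —
by the landed kernel iff `Theorems.PlusMCEtaKUpToMu.plusMCEtaK_iff_muInvariant_eq_of_burungaleTian`
(p473177 = Burungale–Tian 2026 §4 `μ`-criterion transported to the route's datum). Losslessness (19501 ⟺ its
`μ`-part granted the two named facts) is the pointwise content of that iff; an item-level `Iff` record may be
filed separately `--supports` the `μ`-part item (it would be an orphan in this closer).
Closes no cell; 19501 and its `μ`-part stay open; moves no label; no `sorry`.
References: [BurungaleTian2026] Thm. 2.6, Rem. 2.7 (p. 5); [Kobayashi2003] §4 (p. 8), Thm. 2.2; [Washington1997] §13.2.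
-/

namespace Summit.BirchSwinnertonDyer.BirchSwinnertonDyer.Theorems.PlusMCEtaKSplitGlueProof

open Summit.BirchSwinnertonDyer.BirchSwinnertonDyer.Theses.InertBadSignedBranches

/-- **Glue of the 19501 split holds.** [cite: BurungaleTian2026, Thm. 2.6 and Rem. 2.7 (p. 5)]
[cite: Kobayashi2003, §4 (p. 8)] [cite: Washington1997, §13.2] -/
theorem plusMCEtaKSplitGlue : PlusMCEtaKSplitGlue := by
  intro hμ hU hF p _ hp K₀ _ _ _ _ η hη hη1 V _ _ N _ f hCM hgood hap hf ϖ hϖ κ γ hκ hγ hγK hvar Lp hLp D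
  exact (Theorems.PlusMCEtaKUpToMu.plusMCEtaK_iff_muInvariant_eq_of_burungaleTian hF.1 hF.2 p hp K₀ η
    hη hη1 V hCM hgood hap hf ϖ hϖ κ γ hκ hγ hγK hvar Lp hLp D).mpr
    (hμ p hp K₀ η hη hη1 V hCM hgood hap hf ϖ hϖ κ γ hκ hγ hγK hvar Lp hLp D)

end Summit.BirchSwinnertonDyer.BirchSwinnertonDyer.Theorems.PlusMCEtaKSplitGlueProof
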